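import Summits.HodgeConjecture.CorCM.IrreducibleOddWeightsCertificateCovering
import Summits.HodgeConjecture.CorCM.IrreducibleOddWeightsMultiplicityGaloisModel
import Summits.HodgeConjecture.CorCM.IrreducibleOddWeightsHelly
import HarnessLib

/-!
# Wedderburn certificates III: Mai's multiplicity formula, the nondegeneracy criteria and the Helly number read
# through a certificate — no representation theory left as hypothesis

COR-CM (cell `pub-hodgecm2`, binder seat `b16` gen 58, count-neutral claim CERTIFICATES, file F3 — abstract finite-group
level; theorems only, no definition, no named fact, no `sorry`).  NEW as stated, hence under `Summits/`.  HONEST FRAMING: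
finite-dimensional linear algebra over `ℚ` computing the rank of (families of) CM types, i.e. `dim` of the Mumford–Tate
group of a product of CM abelian varieties; `HC_CM` is neither used nor asserted.

The gen-57 files prove `dim U(Σ) = Σ_k d_k · (dim Σ_i Ev_i(π_k) / δ_k)` and its corollaries for pairwise non-isomorphic
irreducible `(π_k, V_k)` covering the spans, `d_k = dim_ℚ V_k`, `δ_k = dim_ℚ End_G V_k`.  F1/F2
(`…Certificate`, `…CertificateCovering`) derive all three hypotheses and `δ_k r_k = d_k` from a WEDDERBURN CERTIFICATE:
`Z_k`-linear actions on `Z_k`-vector spaces `V_k` (`Z_k` division rings, `r_k = dim_{Z_k} V_k`), a COUNT, and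
FAITHFULNESS of `ℚ^G` (full certificate) resp. of the odd functions `ℚ[G]⁻` (odd certificate, `π_k(ρ) = −1`, `ρ² = 1`).
This file substitutes: with a certificate the weight `d_k/δ_k` is `r_k` and no division remains.

* §1 FULL certificate: **`finrank_orbitSpan_eq_sum_of_certificate`** — `dim 𝒪[G, w] = Σ_k r_k · dim Ev[G, π_k, w]` for
  every finite `G`-set `X` and every `w ∈ ℚ^X`.
* §2 ODD certificate, any slots: **`finrank_antiSpan_sigmaType_eq_sum_of_oddCertificate`** (`dim U(Σ) = Σ_k r_k ·
  dim Σ_i Ev_i(π_k)`, i.e. `dim Hg(∏ A_i)`), `typeRank_sigmaType_eq_one_add_sum_of_oddCertificate`, and the HELLY NUMBER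
  **`typeRank_sigmaType_eq_iff_forall_card_le_of_oddCertificate`**: with `r_k ≤ q` for all `k`, the family is nondegenerate
  iff every sub-family of `≤ q + 1` members is.
* §3 ODD certificate, regular slots (the Galois model `G = Gal(L/ℚ)` acting on itself, `Ev = range π_k(u)`):
  **`finrank_antiSpan_sigmaType_eq_sum_finrank_range_of_oddCertificate`** (`dim U(Σ) = Σ_k r_k · dim Σ_i range π_k(u_i)`),
  the nondegeneracy test `typeRank_sigmaType_eq_iff_sum_finrank_range_eq_of_oddCertificate`, and MAI'S CRITERION LITERALLY
  **`typeRank_eq_iff_forall_range_eq_top_of_oddCertificate`**: one type `Ψ` is nondegenerate iff `π_k(u_Ψ)` is ONTO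
  (invertible) for every odd `π_k` of the certificate.

## References

* [Mai1989] L. Mai, *Lower bounds for the ranks of CM types*, J. Number Theory 32 (1989), §2 Prop. 1.
* [Serre1977] J.-P. Serre, *Linear Representations of Finite Groups*, GTM 42 (1977), §6.5 Prop. 16 and §12.2.
* [Kubota1965] T. Kubota, *On the field extension by complex multiplication*, Trans. AMS 118 (1965), §4 Lemma 2.
-/

set_option autoImplicit false

noncomputable section

open scoped BigOperators

universe u u' v w

namespace Summit.HodgeConjecture.CorCM.IrrOdd

open Literature.NumberTheory.ComplexMultiplication

variable {G : Type w} [Group G] [Fintype G]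

/-- The orbit span `𝒪[G, w] = span_ℚ {x ↦ w (g • x) : g ∈ G}` (local notation, no definition). -/
local notation3 (prettyPrint := false) "𝒪[" G' ", " w "]" =>
  Submodule.span ℚ (Set.range fun g : G' => fun x => w (g • x))

/-- The evaluation space `Ev[G, π, w] = {T w : T equivariant}` (local notation, no definition). -/
local notation3 (prettyPrint := false) "Ev[" G' ", " π ", " w "]" =>
  Submodule.span ℚ {v | ∃ T : (_ → ℚ) →ₗ[ℚ] _,
    (∀ (g : G') (f : _ → ℚ), T (fun x => f (g⁻¹ • x)) = π g (T f)) ∧ T w = v}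

variable {K : Type u'} [Fintype K]
variable {V : K → Type*} [∀ k, AddCommGroup (V k)] [∀ k, Module ℚ (V k)] [∀ k, FiniteDimensional ℚ (V k)]
variable {Z : K → Type*} [∀ k, DivisionRing (Z k)] [∀ k, Module (Z k) (V k)] [∀ k, Module.Finite (Z k) (V k)]

/-! ### §0 The weight `d_k / δ_k = r_k` -/

omit [Fintype G] [Fintype K] in
/-- Under `δ r = d` (`δ > 0`) and `δ ∣ e`: `d · (e / δ) = r · e`. [folklore] -/
theorem mul_div_eq_mul_of_mul_eq {δ r d e : ℕ} (hδ : 0 < δ) (h : δ * r = d) (hdvd : δ ∣ e) : d * (e / δ) = r * e := by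
  obtain ⟨m, rfl⟩ := hdvd
  rw [← h, Nat.mul_div_cancel_left m hδ]
  ring

/-! ### §1 The full certificate -/

/-- **MAI'S FORMULA FROM A FULL CERTIFICATE: `dim 𝒪[G, w] = Σ_k r_k · dim Ev[G, π_k, w]`** for every finite `G`-set `X`
and every `w ∈ ℚ^X` — non-zero `Z_k`-linear `π_k`, `Σ_k r_k d_k ≤ |G|`, `ℚ^G` faithful on `⊕_k V_k`; no irreducibility,
disjointness or covering hypothesis, and no `δ_k`. [cite: Mai1989, §2 Prop. 1 (proof)] [cite: Serre1977, §6.5 Prop. 16 and §12.2] -/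
theorem finrank_orbitSpan_eq_sum_of_certificate {X : Type v} [MulAction G X] [Fintype X] (w : X → ℚ)
    (π : ∀ k, Representation ℚ G (V k)) [∀ k, Nontrivial (V k)]
    (hlin : ∀ k (g : G) (z : Z k) (v : V k), π k g (z • v) = z • π k g v)
    (hcount : ∑ k, Module.finrank (Z k) (V k) * Module.finrank ℚ (V k) ≤ Fintype.card G)
    (hfaith : ∀ c : G → ℚ, (∀ k, ∑ g, c g • π k g = 0) → c = 0) :
    Module.finrank ℚ 𝒪[G, w] = ∑ k, Module.finrank (Z k) (V k) * Module.finrank ℚ Ev[G, π k, w] := by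
  classical
  have hcount' : ∑ k, Module.finrank (Z k) (V k) * Module.finrank ℚ (V k) ≤
      Module.finrank ℚ (⊤ : Submodule ℚ (G → ℚ)) := by
    rwa [finrank_top, Module.finrank_fintype_fun_eq_card]
  have hfaith' : ∀ c ∈ (⊤ : Submodule ℚ (G → ℚ)), (∀ k, ∑ g, c g • π k g = 0) → c = 0 := fun c _ hc => hfaith c hc
  obtain ⟨hdvd, hsum⟩ := finrank_orbitSpan_eq_sum w π
    (fun k => isIrreducible_of_certificate π hlin ⊤ hcount' hfaith' k)
    (fun k l hkl S => intertwiningMap_eq_zero_of_certificate π hlin ⊤ hcount' hfaith' hkl S)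
    (fun P _ hP0 hPst => cover_perm_of_certificate π hlin hcount hfaith P hP0 hPst)
  rw [hsum]
  refine Finset.sum_congr rfl fun k _ => mul_div_eq_mul_of_mul_eq
    (finrank_intertwiningMap_pos (π k) (isIrreducible_of_certificate π hlin ⊤ hcount' hfaith' k))
    (finrank_intertwiningMap_mul_eq_of_certificate π hlin ⊤ hcount' hfaith' k) (hdvd k)

/-! ### §2 The odd certificate: families on arbitrary slots -/

section Slots

variable {I : Type u} {E : I → Type v} [∀ i, MulAction G (E i)] [Fintype I] [∀ i, Fintype (E i)]

/-- **`dim U(Σ) = Σ_k r_k · dim Σ_i Ev_i(π_k)` FROM AN ODD CERTIFICATE** (`= dim Hg(∏_i A_i)`): `ρ² = 1`, the `Φ_i` CM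
types for `ρ`, non-zero `Z_k`-linear `π_k` with `π_k(ρ) = −1`, `Σ_k r_k d_k ≤ dim ℚ[G]⁻`, `ℚ[G]⁻` faithful on `⊕_k V_k`.
[cite: Mai1989, §2 Prop. 1 (proof)] [cite: Serre1977, §6.5 Prop. 16 and §12.2] -/
theorem finrank_antiSpan_sigmaType_eq_sum_of_oddCertificate {ρ : G} {Φ : ∀ i, Set (E i)}
    (h : ∀ i, IsCMTypeWith ρ (Φ i)) (π : ∀ k, Representation ℚ G (V k)) [∀ k, Nontrivial (V k)]
    (hlin : ∀ k (g : G) (z : Z k) (v : V k), π k g (z • v) = z • π k g v) (hρ2 : ρ * ρ = 1)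
    (hodd : ∀ k (v : V k), π k ρ v = -v)
    (hcount : ∑ k, Module.finrank (Z k) (V k) * Module.finrank ℚ (V k) ≤
      Module.finrank ℚ (antiWeights (E := G) ρ))
    (hfaith : ∀ c : G → ℚ, (∀ g, c (ρ * g) = -c g) → (∀ k, ∑ g, c g • π k g = 0) → c = 0) :
    Module.finrank ℚ (antiSpan G (sigmaType Φ)) =
      ∑ k, Module.finrank (Z k) (V k) *
        Module.finrank ℚ (⨆ i, Ev[G, π k, antiVec (Φ i) (1 : G)] : Submodule ℚ (V k)) := by
  classical
  have hfaith' : ∀ c ∈ antiWeights (E := G) ρ, (∀ k, ∑ g, c g • π k g = 0) → c = 0 := fun c hc h0 =>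
    hfaith c (mem_antiWeights_iff'.1 hc) h0
  have hirr := fun k => isIrreducible_of_certificate π hlin _ hcount hfaith' k
  have hne := fun k l (hkl : k ≠ l) (S : (π k).IntertwiningMap (π l)) =>
    intertwiningMap_eq_zero_of_certificate π hlin _ hcount hfaith' hkl S
  have hcov : ∀ (i : I) (P : Submodule ℚ (E i → ℚ)), P ≤ antiSpan G (Φ i) → P ≠ ⊥ →
      (∀ (g : G) (a : E i → ℚ), a ∈ P → (fun s => a (g • s)) ∈ P) →
      ∃ k, ∃ T : (E i → ℚ) →ₗ[ℚ] V k,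
        (∀ (g : G) (a : E i → ℚ), T (fun s => a (g⁻¹ • s)) = π k g (T a)) ∧ ∃ a ∈ P, T a ≠ 0 :=
    fun i P hPU hP0 hPst => cover_perm_of_oddCertificate π hlin hρ2 hodd hcount hfaith P hP0 hPst
      (hPU.trans (antiSpan_le_antiWeights' (h i)))
  obtain ⟨hdvd, hsum⟩ := finrank_antiSpan_sigmaType_eq_sum Φ π hirr hne (cover_sigmaType_of_forall Φ π hcov)
  rw [hsum]
  refine Finset.sum_congr rfl fun k _ => mul_div_eq_mul_of_mul_eq (finrank_intertwiningMap_pos (π k) (hirr k))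
    (finrank_intertwiningMap_mul_eq_of_certificate π hlin _ hcount hfaith' k) (hdvd k)

/-- **`rank(Σ) = 1 + Σ_k r_k · dim Σ_i Ev_i(π_k)`** (`dim MT(∏_i A_i)`) from an odd certificate.
[cite: Mai1989, §2 Prop. 1 (proof)] [cite: Serre1977, §6.5 Prop. 16 and §12.2] -/
theorem typeRank_sigmaType_eq_one_add_sum_of_oddCertificate [Nonempty (Σ i, E i)] {ρ : G} {Φ : ∀ i, Set (E i)}
    (h : ∀ i, IsCMTypeWith ρ (Φ i)) (π : ∀ k, Representation ℚ G (V k)) [∀ k, Nontrivial (V k)]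
    (hlin : ∀ k (g : G) (z : Z k) (v : V k), π k g (z • v) = z • π k g v) (hρ2 : ρ * ρ = 1)
    (hodd : ∀ k (v : V k), π k ρ v = -v)
    (hcount : ∑ k, Module.finrank (Z k) (V k) * Module.finrank ℚ (V k) ≤
      Module.finrank ℚ (antiWeights (E := G) ρ))
    (hfaith : ∀ c : G → ℚ, (∀ g, c (ρ * g) = -c g) → (∀ k, ∑ g, c g • π k g = 0) → c = 0) :
    typeRank G (sigmaType Φ) = 1 + ∑ k, Module.finrank (Z k) (V k) *
        Module.finrank ℚ (⨆ i, Ev[G, π k, antiVec (Φ i) (1 : G)] : Submodule ℚ (V k)) := by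
  rw [(IsCMTypeWith.sigmaType h).typeRank_eq_finrank_antiSpan_add_one,
    finrank_antiSpan_sigmaType_eq_sum_of_oddCertificate h π hlin hρ2 hodd hcount hfaith, add_comm]

/-- **Nondegeneracy from an odd certificate**: `rank(Σ) = |⊔_i E_i|/2 + 1` iff `Σ_k r_k · dim Σ_i Ev_i(π_k) = |⊔_i E_i|/2`.
[cite: Mai1989, §2 Prop. 1] [cite: Kubota1965, §4 Lemma 2] -/
theorem typeRank_sigmaType_eq_iff_sum_eq_of_oddCertificate [Nonempty (Σ i, E i)] {ρ : G} {Φ : ∀ i, Set (E i)}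
    (h : ∀ i, IsCMTypeWith ρ (Φ i)) (π : ∀ k, Representation ℚ G (V k)) [∀ k, Nontrivial (V k)]
    (hlin : ∀ k (g : G) (z : Z k) (v : V k), π k g (z • v) = z • π k g v) (hρ2 : ρ * ρ = 1)
    (hodd : ∀ k (v : V k), π k ρ v = -v)
    (hcount : ∑ k, Module.finrank (Z k) (V k) * Module.finrank ℚ (V k) ≤
      Module.finrank ℚ (antiWeights (E := G) ρ))
    (hfaith : ∀ c : G → ℚ, (∀ g, c (ρ * g) = -c g) → (∀ k, ∑ g, c g • π k g = 0) → c = 0) :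
    typeRank G (sigmaType Φ) = Fintype.card (Σ i, E i) / 2 + 1 ↔
      ∑ k, Module.finrank (Z k) (V k) *
        Module.finrank ℚ (⨆ i, Ev[G, π k, antiVec (Φ i) (1 : G)] : Submodule ℚ (V k)) =
          Fintype.card (Σ i, E i) / 2 := by
  rw [typeRank_sigmaType_eq_one_add_sum_of_oddCertificate h π hlin hρ2 hodd hcount hfaith]
  omega

/-- **THE HELLY NUMBER FROM AN ODD CERTIFICATE**: if `r_k = dim_{Z_k} V_k ≤ q` for every member of the certificate, the
family is nondegenerate (`Hg(∏_i A_i) = ∏_i Hg(A_i)` of maximal rank) iff every non-empty sub-family of at most `q + 1`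
members is. [cite: Mai1989, §2 Prop. 1 (proof)] [cite: Gordon1999HodgeAVSurvey, §3 and 7.5–7.7] -/
theorem typeRank_sigmaType_eq_iff_forall_card_le_of_oddCertificate [∀ i, Nonempty (E i)] [Nonempty I] {ρ : G}
    {Φ : ∀ i, Set (E i)} (h : ∀ i, IsCMTypeWith ρ (Φ i)) (π : ∀ k, Representation ℚ G (V k)) [∀ k, Nontrivial (V k)]
    (hlin : ∀ k (g : G) (z : Z k) (v : V k), π k g (z • v) = z • π k g v) (hρ2 : ρ * ρ = 1)
    (hodd : ∀ k (v : V k), π k ρ v = -v)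
    (hcount : ∑ k, Module.finrank (Z k) (V k) * Module.finrank ℚ (V k) ≤
      Module.finrank ℚ (antiWeights (E := G) ρ))
    (hfaith : ∀ c : G → ℚ, (∀ g, c (ρ * g) = -c g) → (∀ k, ∑ g, c g • π k g = 0) → c = 0)
    (q : ℕ) (hq : ∀ k, Module.finrank (Z k) (V k) ≤ q) :
    typeRank G (sigmaType Φ) = Fintype.card (Σ i, E i) / 2 + 1 ↔
      ∀ T : Finset I, T.Nonempty → T.card ≤ q + 1 →
        typeRank G (sigmaType fun j : (T : Set I) => Φ j) = Fintype.card (Σ j : (T : Set I), E j) / 2 + 1 := by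
  classical
  have hfaith' : ∀ c ∈ antiWeights (E := G) ρ, (∀ k, ∑ g, c g • π k g = 0) → c = 0 := fun c hc h0 =>
    hfaith c (mem_antiWeights_iff'.1 hc) h0
  have hirr := fun k => isIrreducible_of_certificate π hlin _ hcount hfaith' k
  refine typeRank_sigmaType_eq_iff_forall_card_le h π hirr
    (fun k l hkl S => intertwiningMap_eq_zero_of_certificate π hlin _ hcount hfaith' hkl S)
    (fun i P hPU hP0 hPst => cover_perm_of_oddCertificate π hlin hρ2 hodd hcount hfaith P hP0 hPst
      (hPU.trans (antiSpan_le_antiWeights' (h i)))) q fun k => ?_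
  rw [← finrank_intertwiningMap_mul_eq_of_certificate π hlin _ hcount hfaith' k, mul_comm q]
  exact Nat.mul_le_mul_left _ (hq k)

end Slots

/-! ### §3 The odd certificate on regular slots: the Galois model -/

section Regular

variable [DecidableEq G] {I : Type u} [Fintype I]

/-- **THE CENSUS FORMULA: `dim U(Σ) = Σ_k r_k · dim Σ_i range π_k(u_i)`** for types `Ψ_i ⊆ G` of a finite group acting
on itself (`u_i = u_1(Ψ_i)`, `π_k(u_i) = Σ_g u_i(g) π_k(g)`), from an ODD certificate — for `G = Gal(L/ℚ)` this is
`dim Hg(∏_i A_i)` (the tree's dictionary `cmFamilyRank_eq_typeRank_gal`).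
[cite: Mai1989, §2 Prop. 1 (proof)] [cite: Kubota1965, §4 Lemma 2] -/
theorem finrank_antiSpan_sigmaType_eq_sum_finrank_range_of_oddCertificate {ρ : G} (Ψ : I → Set G)
    (h : ∀ i, IsCMTypeWith ρ (Ψ i)) (π : ∀ k, Representation ℚ G (V k)) [∀ k, Nontrivial (V k)]
    (hlin : ∀ k (g : G) (z : Z k) (v : V k), π k g (z • v) = z • π k g v) (hρ2 : ρ * ρ = 1)
    (hodd : ∀ k (v : V k), π k ρ v = -v)
    (hcount : ∑ k, Module.finrank (Z k) (V k) * Module.finrank ℚ (V k) ≤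
      Module.finrank ℚ (antiWeights (E := G) ρ))
    (hfaith : ∀ c : G → ℚ, (∀ g, c (ρ * g) = -c g) → (∀ k, ∑ g, c g • π k g = 0) → c = 0) :
    Module.finrank ℚ (antiSpan G (sigmaType (E := fun _ : I => G) Ψ)) = ∑ k, Module.finrank (Z k) (V k) *
      Module.finrank ℚ (⨆ i, LinearMap.range (∑ g, antiVec (Ψ i) (1 : G) g • π k g) : Submodule ℚ (V k)) := by
  classical
  rw [finrank_antiSpan_sigmaType_eq_sum_of_oddCertificate (E := fun _ : I => G) h π hlin hρ2 hodd hcount hfaith]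
  refine Finset.sum_congr rfl fun k _ => ?_
  congr 1
  exact congrArg (fun S : Submodule ℚ (V k) => Module.finrank ℚ S)
    (iSup_congr fun i => evalSpace_eq_range_of_regular (π k) (antiVec (Ψ i) (1 : G)))

/-- **The census nondegeneracy test**: `rank(Σ) = |I|·|G|/2 + 1` iff `Σ_k r_k · dim Σ_i range π_k(u_i) = |I|·|G|/2`.
[cite: Mai1989, §2 Prop. 1] [cite: Kubota1965, §4 Lemma 2] -/
theorem typeRank_sigmaType_eq_iff_sum_finrank_range_eq_of_oddCertificate [Nonempty I] {ρ : G} (Ψ : I → Set G)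
    (h : ∀ i, IsCMTypeWith ρ (Ψ i)) (π : ∀ k, Representation ℚ G (V k)) [∀ k, Nontrivial (V k)]
    (hlin : ∀ k (g : G) (z : Z k) (v : V k), π k g (z • v) = z • π k g v) (hρ2 : ρ * ρ = 1)
    (hodd : ∀ k (v : V k), π k ρ v = -v)
    (hcount : ∑ k, Module.finrank (Z k) (V k) * Module.finrank ℚ (V k) ≤
      Module.finrank ℚ (antiWeights (E := G) ρ))
    (hfaith : ∀ c : G → ℚ, (∀ g, c (ρ * g) = -c g) → (∀ k, ∑ g, c g • π k g = 0) → c = 0) :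
    typeRank G (sigmaType (E := fun _ : I => G) Ψ) = Fintype.card (Σ _ : I, G) / 2 + 1 ↔
      ∑ k, Module.finrank (Z k) (V k) *
        Module.finrank ℚ (⨆ i, LinearMap.range (∑ g, antiVec (Ψ i) (1 : G) g • π k g) : Submodule ℚ (V k)) =
          Fintype.card (Σ _ : I, G) / 2 := by
  obtain ⟨i₀⟩ := ‹Nonempty I›
  haveI : Nonempty (Σ _ : I, G) := ⟨⟨i₀, 1⟩⟩
  rw [(IsCMTypeWith.sigmaType (E := fun _ : I => G) h).typeRank_eq_finrank_antiSpan_add_one,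
    finrank_antiSpan_sigmaType_eq_sum_finrank_range_of_oddCertificate Ψ h π hlin hρ2 hodd hcount hfaith]
  omega

/-- **MAI'S CRITERION, LITERALLY, from an odd certificate: one type `Ψ ⊆ G` is nondegenerate (`rank = |G|/2 + 1`) iff
`π_k(u_Ψ) = Σ_g u_Ψ(g) π_k(g)` is ONTO `V_k` (i.e. invertible) for every odd representation `π_k` of the certificate**
(on odd `π_k`, `1 − π_k(ρ) = 2` is invertible, so the tree's `rank π_k(u) = rank(1 − π_k(ρ))` reads `range π_k(u) = V_k`).
[cite: Mai1989, §2 Prop. 1] [cite: Kubota1965, §4 Lemma 2] -/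
theorem typeRank_eq_iff_forall_range_eq_top_of_oddCertificate {ρ : G} {Ψ : Set G} (h : IsCMTypeWith ρ Ψ)
    (π : ∀ k, Representation ℚ G (V k)) [∀ k, Nontrivial (V k)]
    (hlin : ∀ k (g : G) (z : Z k) (v : V k), π k g (z • v) = z • π k g v) (hρ2 : ρ * ρ = 1)
    (hodd : ∀ k (v : V k), π k ρ v = -v)
    (hcount : ∑ k, Module.finrank (Z k) (V k) * Module.finrank ℚ (V k) ≤
      Module.finrank ℚ (antiWeights (E := G) ρ))
    (hfaith : ∀ c : G → ℚ, (∀ g, c (ρ * g) = -c g) → (∀ k, ∑ g, c g • π k g = 0) → c = 0) :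
    typeRank G Ψ = Fintype.card G / 2 + 1 ↔ ∀ k, LinearMap.range (∑ g, antiVec Ψ (1 : G) g • π k g) = ⊤ := by
  classical
  have hfaith' : ∀ c ∈ antiWeights (E := G) ρ, (∀ k, ∑ g, c g • π k g = 0) → c = 0 := fun c hc h0 =>
    hfaith c (mem_antiWeights_iff'.1 hc) h0
  have hirr := fun k => isIrreducible_of_certificate π hlin _ hcount hfaith' k
  have hne := fun k l (hkl : k ≠ l) (S : (π k).IntertwiningMap (π l)) =>
    intertwiningMap_eq_zero_of_certificate π hlin _ hcount hfaith' hkl S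
  rw [typeRank_eq_iff_forall_finrank_range_eq h π hirr hne fun P hPU hP0 hPst =>
    cover_perm_of_oddCertificate π hlin hρ2 hodd hcount hfaith P hP0 hPst hPU]
  -- on odd `π_k`, `1 − π_k(ρ) = 2` is onto
  have htwo : ∀ k, LinearMap.range (1 - π k ρ) = ⊤ := fun k => by
    rw [LinearMap.range_eq_top]
    intro v
    refine ⟨(1 / 2 : ℚ) • v, ?_⟩
    rw [LinearMap.sub_apply, Module.End.one_apply, map_smul, hodd, smul_neg, sub_neg_eq_add, ← add_smul]
    norm_num
  refine forall_congr' fun k => ?_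
  rw [htwo k, finrank_top]
  constructor
  · intro hk
    exact Submodule.eq_top_of_finrank_eq hk
  · intro hk
    rw [hk, finrank_top]

end Regular

end Summit.HodgeConjecture.CorCM.IrrOdd

end
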